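import Mathlib
import Summits.ResolutionOfSingularities.ResolutionOfSingularities.Theorems.WildQuotientsWildQuotientResolutionJordanFourTwistedChart

/-!
# V4U piece T — the action of `⟨σ⟩` through the twisted chart: `ψ_T ∘ g = Σ_T^m ∘ ψ_T` for every `g ∈ ⟨σ⟩`, and «invariant under `⟨σ⟩`» = «`Σ_T`-fixed»

(crux stmt-ResolutionOfSingularities-15640 `WildQuotients.WildQuotientResolution`, line `Sketch`,
sector `|G| = p`; programme V4U of `L/w45c/CHAIN.md` v7.6 §4, res-L1-w45c-plan-1's named object
2026-08-27T07:13:11Z (b) for row stub-1: the ACTION-INTERTWINING INPUT of the `μ₂` ring brick `H₁`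
(res-type-036) — and, by the generic half, of the `μ₃` ring brick `H₀` (res-type-087).
[OURS · L1 W4.5c] — NOT a statement of any manuscript; replaces the role of no printed item.
Prover res-L1-w45c-stub-1.)

The E-engine `ToricExit.map_away_eq_of_intertwines` (res-L1-w45c-stub-5) and the seam
`BlowupExit…BasicOpenSections` reduce the identification «range of the cone presentation = ring of
invariants of the piece» to the ROOT-CHART INTERTWINING `Sg ∘ ψ = ψ ∘ (g⁻¹ • ·)` on `R = k[x]`, for EVERY
element `g` of the group `⟨σ⟩ = Subgroup.zpowers σ` acting by the affine-quotient law
`MulSemiringAction.toRingEquiv ⟨σ⟩ k[x] g⁻¹`. T-i (`JordanFour.twistedChart_map`, p499653) is the case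
`g = σ`, `Sg = Σ_T` (the translation `ξ ↦ ξ + s`). This file packages the general element:

* generic (`ψ : A →ₐ[k] B`, `σ : A ≃ₐ[k] A`, `T : B →ₐ[k] B`, `ψ ∘ σ = T ∘ ψ`):
  `map_pow_apply_of_intertwines` (`ψ ∘ σ^m = T^m ∘ ψ`), `toRingEquiv_zpowers_apply`
  (`toRingEquiv ⟨σ⟩ A g f = g f`), `exists_coe_zpowers_eq_pow` (finite `⟨σ⟩`: every `g` is a `σ^m`,
  `m : ℕ`), `exists_expo_of_intertwines` (ONE exponent function `m : ⟨σ⟩ → ℕ` with `m σ = 1` and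
  `ψ (g • f) = T^{m g} (ψ f)` for all `g`, `f`), `pow_apply_algebraMap_of_semiconj` (extension to any
  algebra `S` with `τS ∘ algebraMap = algebraMap ∘ T`), `forall_pow_apply_eq_iff_of_exists_eq_one`
  (fixed under all `T^{m g}` iff fixed under `T`), and the assembled
  `exists_expo_algebraMap_and_fixed_iff` — the two facts a brick needs: the intertwining for every `g`
  and «fixed by every `g`» = «fixed by `τS`»;
* instances for the twisted chart `ψ_T = JordanFour.twistedChart k n a b c d` and the `J₄` datum `σ`
  (`x_b ↦ x_b + x_a`, `x_c ↦ x_c + x_b`, `x_d ↦ x_d + x_c`), `Σ_T` ANY endomorphism with `ξ ↦ ξ + s`: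
  `twistedChart_pow_apply`, `twistedChart_toRingEquiv_zpowers_self`,
  `exists_twistedChart_toRingEquiv_eq_pow`, `exists_twistedChart_expo`,
  `exists_twistedChart_expo_algebraMap_and_fixed_iff` (the `H₁` input in `E_Q ⊆ k[x][1/Q]` form:
  `S` any `k[x]`-algebra, `τS` over `Σ_T` as in (G1c) `BlowupExitAway.fixedPoints_adjoin_away_eq`).
-/

-- single-problem summit: the doubled namespace component `ResolutionOfSingularities` is forced
set_option linter.dupNamespace false

noncomputable section

open MvPolynomial

namespace Summit.ResolutionOfSingularities.ResolutionOfSingularities.Theorems.WildQuotientResolution.JordanFour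

/-! ## Generic: intertwining along natural powers and along the cyclic group `⟨σ⟩` -/

section Generic

variable {k A B : Type*} [CommSemiring k] [Semiring A] [Semiring B] [Algebra k A] [Algebra k B]
  (ψ : A →ₐ[k] B) (σ : A ≃ₐ[k] A) (T : B →ₐ[k] B) (h : ∀ f, ψ (σ f) = T (ψ f))

include h in
/-- If `ψ ∘ σ = T ∘ ψ` then `ψ ∘ σ^m = T^m ∘ ψ` for every `m : ℕ`. [folklore] -/
theorem map_pow_apply_of_intertwines (m : ℕ) (f : A) : ψ ((σ ^ m) f) = (T ^ m) (ψ f) := by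
  induction m generalizing f with
  | zero => rw [pow_zero, pow_zero, AlgEquiv.one_apply, AlgHom.one_apply]
  | succ m ih => rw [pow_succ, AlgEquiv.mul_apply, ih, h, pow_succ, AlgHom.mul_apply]

/-- The affine-quotient law of the cyclic group `⟨σ⟩ ≤ Aut_k(A)` on `A`:
`MulSemiringAction.toRingEquiv ⟨σ⟩ A g` is `g` itself. [folklore] -/
theorem toRingEquiv_zpowers_apply (g : Subgroup.zpowers σ) (f : A) :
    MulSemiringAction.toRingEquiv (Subgroup.zpowers σ) A g f = (g : A ≃ₐ[k] A) f := rfl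

/-- In a FINITE cyclic group `⟨σ⟩` every element is a natural power of `σ`. [folklore] -/
theorem exists_coe_zpowers_eq_pow [Finite (Subgroup.zpowers σ)] (g : Subgroup.zpowers σ) :
    ∃ m : ℕ, (g : A ≃ₐ[k] A) = σ ^ m := by
  have hfin : IsOfFinOrder σ := finite_zpowers.mp (Set.toFinite _)
  obtain ⟨m, hm⟩ := hfin.mem_powers_iff_mem_zpowers.mpr g.2
  exact ⟨m, hm.symm⟩

include h in
/-- For every `g ∈ ⟨σ⟩` (finite) there is `m : ℕ` with `ψ (g • f) = T^m (ψ f)` for all `f`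
(`g • f = MulSemiringAction.toRingEquiv ⟨σ⟩ A g f`, the affine-quotient law). [folklore] -/
theorem exists_map_toRingEquiv_eq_pow [Finite (Subgroup.zpowers σ)] (g : Subgroup.zpowers σ) :
    ∃ m : ℕ, ∀ f, ψ (MulSemiringAction.toRingEquiv (Subgroup.zpowers σ) A g f) = (T ^ m) (ψ f) := by
  obtain ⟨m, hm⟩ := exists_coe_zpowers_eq_pow σ g
  exact ⟨m, fun f => by rw [toRingEquiv_zpowers_apply, hm, map_pow_apply_of_intertwines ψ σ T h]⟩

include h in
/-- The generator: `ψ (σ • f) = T (ψ f)` with `σ` viewed as the element `⟨σ, _⟩` of `⟨σ⟩`. [folklore] -/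
theorem map_toRingEquiv_zpowers_self (f : A) :
    ψ (MulSemiringAction.toRingEquiv (Subgroup.zpowers σ) A ⟨σ, Subgroup.mem_zpowers σ⟩ f) =
      T (ψ f) := by
  rw [toRingEquiv_zpowers_apply]
  exact h f

include h in
/-- **One exponent function for the whole group**: there is `m : ⟨σ⟩ → ℕ` with `m σ = 1` and
`ψ (g • f) = T^{m g} (ψ f)` for all `g ∈ ⟨σ⟩` and all `f`. [folklore] -/
theorem exists_expo_of_intertwines [Finite (Subgroup.zpowers σ)] :
    ∃ m : Subgroup.zpowers σ → ℕ, m ⟨σ, Subgroup.mem_zpowers σ⟩ = 1 ∧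
      ∀ (g : Subgroup.zpowers σ) (f : A),
        ψ (MulSemiringAction.toRingEquiv (Subgroup.zpowers σ) A g f) = (T ^ m g) (ψ f) := by
  classical
  choose m hm using fun g : Subgroup.zpowers σ => exists_map_toRingEquiv_eq_pow ψ σ T h g
  refine ⟨fun g => if g = ⟨σ, Subgroup.mem_zpowers σ⟩ then 1 else m g, ?_, ?_⟩
  · dsimp only
    rw [if_pos rfl]
  intro g f
  dsimp only
  by_cases hg : g = ⟨σ, Subgroup.mem_zpowers σ⟩
  · subst hg
    rw [if_pos rfl, pow_one]
    exact map_toRingEquiv_zpowers_self ψ σ T h f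
  · rw [if_neg hg]
    exact hm g f

/-- Extension to an algebra `S` over `B`: if `τS ∘ algebraMap = algebraMap ∘ T` then
`τS^m ∘ algebraMap = algebraMap ∘ T^m`. [folklore] -/
theorem pow_apply_algebraMap_of_semiconj {B S : Type*} [CommSemiring B] [Semiring S] [Algebra k B]
    [Algebra k S] [Algebra B S] (T : B →ₐ[k] B) (τS : S →ₐ[k] S)
    (hτS : ∀ r, τS (algebraMap B S r) = algebraMap B S (T r)) (m : ℕ) (r : B) :
    (τS ^ m) (algebraMap B S r) = algebraMap B S ((T ^ m) r) := by
  induction m generalizing r with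
  | zero => rw [pow_zero, pow_zero, AlgHom.one_apply, AlgHom.one_apply]
  | succ m ih => rw [pow_succ, AlgHom.mul_apply, hτS, ih, pow_succ, AlgHom.mul_apply]

/-- Fixed under all the powers `T^{m i}` of a family of exponents containing `1` iff fixed under `T`.
[folklore] -/
theorem forall_pow_apply_eq_iff_of_exists_eq_one {S : Type*} [Semiring S] [Algebra k S]
    (τS : S →ₐ[k] S) {ι : Type*} (m : ι → ℕ) (h1 : ∃ i, m i = 1) (x : S) :
    (∀ i, (τS ^ m i) x = x) ↔ τS x = x := by
  constructor
  · intro hx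
    obtain ⟨i, hi⟩ := h1
    have := hx i
    rwa [hi, pow_one] at this
  · intro hx i
    induction m i with
    | zero => rw [pow_zero, AlgHom.one_apply]
    | succ j ih => rw [pow_succ, AlgHom.mul_apply, hx, ih]

/-- **The brick input, assembled (generic).** `ψ : A → B` intertwining `σ` with `T`, `⟨σ⟩` finite,
`S` a `B`-algebra with an endomorphism `τS` over `T`. Then ONE exponent function `m : ⟨σ⟩ → ℕ`
gives (i) `τS^{m g} (ψ f) = ψ (g • f)` in `S` for every `g ∈ ⟨σ⟩` — the hypothesis `hSg` of
`ToricExit.map_away_eq_of_intertwines` / of the seam for the endomorphism `Sg := τS^{m g}` — and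
(ii) an element of `S` is fixed by every `τS^{m g}` iff it is fixed by `τS`. [folklore] -/
theorem exists_expo_algebraMap_and_fixed_iff {A B S : Type*} [Semiring A] [CommSemiring B]
    [Semiring S] [Algebra k A] [Algebra k B] [Algebra k S] [Algebra B S]
    (ψ : A →ₐ[k] B) (σ : A ≃ₐ[k] A) (T : B →ₐ[k] B) (h : ∀ f, ψ (σ f) = T (ψ f))
    [Finite (Subgroup.zpowers σ)] (τS : S →ₐ[k] S)
    (hτS : ∀ r, τS (algebraMap B S r) = algebraMap B S (T r)) :
    ∃ m : Subgroup.zpowers σ → ℕ, m ⟨σ, Subgroup.mem_zpowers σ⟩ = 1 ∧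
      (∀ (g : Subgroup.zpowers σ) (f : A),
        (τS ^ m g) (algebraMap B S (ψ f)) =
          algebraMap B S (ψ (MulSemiringAction.toRingEquiv (Subgroup.zpowers σ) A g f))) ∧
      ∀ x : S, (∀ g : Subgroup.zpowers σ, (τS ^ m g) x = x) ↔ τS x = x := by
  obtain ⟨m, hm1, hm⟩ := exists_expo_of_intertwines ψ σ T h
  refine ⟨m, hm1, fun g f => ?_, fun x => ?_⟩
  · rw [pow_apply_algebraMap_of_semiconj T τS hτS, hm g f]
  · exact forall_pow_apply_eq_iff_of_exists_eq_one τS m ⟨_, hm1⟩ x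

end Generic

/-! ## The twisted chart of `J₄`: every `g ∈ ⟨σ⟩` acts as a power of the translation `Σ_T` -/

section Twisted

variable (k : Type) [Field k] (n : ℕ) (a b c d : Fin n)
  (hab : a ≠ b) (hac : a ≠ c) (had : a ≠ d) (hbc : b ≠ c) (hbd : b ≠ d) (hcd : c ≠ d)
  (τ : MvPolynomial (Fin n) k →ₐ[k] MvPolynomial (Fin n) k)
  (hτc : τ (X c) = X c + X b) (hτ : ∀ i, i ≠ c → τ (X i) = X i)
  (σ : MvPolynomial (Fin n) k ≃ₐ[k] MvPolynomial (Fin n) k)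
  (hσb : σ (X b) = X b + X a) (hσc : σ (X c) = X c + X b) (hσd : σ (X d) = X d + X c)
  (hσ : ∀ i, i ≠ b → i ≠ c → i ≠ d → σ (X i) = X i)

include hab hac had hbc hbd hcd hτc hτ hσb hσc hσd hσ in
/-- **`ψ_T ∘ σ^m = Σ_T^m ∘ ψ_T`**: the `m`-th iterate of the wild automorphism is, on the twisted chart,
the translation `ξ ↦ ξ + m s`. [OURS · L1 W4.5c] -/
theorem twistedChart_pow_apply (h2 : (2 : k) ≠ 0) (h3 : (3 : k) ≠ 0) (m : ℕ)
    (f : MvPolynomial (Fin n) k) :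
    twistedChart k n a b c d ((σ ^ m) f) = (τ ^ m) (twistedChart k n a b c d f) :=
  map_pow_apply_of_intertwines (twistedChart k n a b c d) σ τ
    (twistedChart_map k n a b c d hab hac had hbc hbd hcd τ hτc hτ
      (σ : MvPolynomial (Fin n) k →ₐ[k] MvPolynomial (Fin n) k) hσb hσc hσd hσ h2 h3) m f

include hab hac had hbc hbd hcd hτc hτ hσb hσc hσd hσ in
/-- The generator in affine-quotient-law form: `ψ_T (toRingEquiv ⟨σ⟩ k[x] σ f) = Σ_T (ψ_T f)`.
[OURS · L1 W4.5c] -/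
theorem twistedChart_toRingEquiv_zpowers_self (h2 : (2 : k) ≠ 0) (h3 : (3 : k) ≠ 0)
    (f : MvPolynomial (Fin n) k) :
    twistedChart k n a b c d (MulSemiringAction.toRingEquiv (Subgroup.zpowers σ)
        (MvPolynomial (Fin n) k) ⟨σ, Subgroup.mem_zpowers σ⟩ f) =
      τ (twistedChart k n a b c d f) :=
  map_toRingEquiv_zpowers_self (twistedChart k n a b c d) σ τ
    (twistedChart_map k n a b c d hab hac had hbc hbd hcd τ hτc hτ
      (σ : MvPolynomial (Fin n) k →ₐ[k] MvPolynomial (Fin n) k) hσb hσc hσd hσ h2 h3) f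

include hab hac had hbc hbd hcd hτc hτ hσb hσc hσd hσ in
/-- **Every `g ∈ ⟨σ⟩` is a power of `Σ_T` on the twisted chart**: `∃ m, ψ_T (g • f) = Σ_T^m (ψ_T f)`
for all `f` (finite `⟨σ⟩`, e.g. `JordanFour.finite_zpowers` in characteristic `p ≥ 5`); apply at `g⁻¹`
for the coefficient map `toRingEquiv ⟨σ⟩ k[x] g⁻¹` of the graded endomorphism `φ_g`.
[OURS · L1 W4.5c] -/
theorem exists_twistedChart_toRingEquiv_eq_pow (h2 : (2 : k) ≠ 0) (h3 : (3 : k) ≠ 0)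
    [Finite (Subgroup.zpowers σ)] (g : Subgroup.zpowers σ) :
    ∃ m : ℕ, ∀ f : MvPolynomial (Fin n) k,
      twistedChart k n a b c d (MulSemiringAction.toRingEquiv (Subgroup.zpowers σ)
          (MvPolynomial (Fin n) k) g f) =
        (τ ^ m) (twistedChart k n a b c d f) :=
  exists_map_toRingEquiv_eq_pow (twistedChart k n a b c d) σ τ
    (twistedChart_map k n a b c d hab hac had hbc hbd hcd τ hτc hτ
      (σ : MvPolynomial (Fin n) k →ₐ[k] MvPolynomial (Fin n) k) hσb hσc hσd hσ h2 h3) g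

include hab hac had hbc hbd hcd hτc hτ hσb hσc hσd hσ in
/-- One exponent function for `⟨σ⟩` on the twisted chart, normalised by `m σ = 1`. [OURS · L1 W4.5c] -/
theorem exists_twistedChart_expo (h2 : (2 : k) ≠ 0) (h3 : (3 : k) ≠ 0)
    [Finite (Subgroup.zpowers σ)] :
    ∃ m : Subgroup.zpowers σ → ℕ, m ⟨σ, Subgroup.mem_zpowers σ⟩ = 1 ∧
      ∀ (g : Subgroup.zpowers σ) (f : MvPolynomial (Fin n) k),
        twistedChart k n a b c d (MulSemiringAction.toRingEquiv (Subgroup.zpowers σ)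
            (MvPolynomial (Fin n) k) g f) =
          (τ ^ m g) (twistedChart k n a b c d f) :=
  exists_expo_of_intertwines (twistedChart k n a b c d) σ τ
    (twistedChart_map k n a b c d hab hac had hbc hbd hcd τ hτc hτ
      (σ : MvPolynomial (Fin n) k →ₐ[k] MvPolynomial (Fin n) k) hσb hσc hσd hσ h2 h3)

include hab hac had hbc hbd hcd hτc hτ hσb hσc hσd hσ in
/-- **The `H₁` input.** For any `k[x]`-algebra `S` (e.g. `k[x][1/Q] ⊇ E_Q`) with an endomorphism
`τS` over `Σ_T` (`τS ∘ algebraMap = algebraMap ∘ Σ_T`; `Σ_T Q = Q`), one exponent function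
`m : ⟨σ⟩ → ℕ` (with `m σ = 1`) satisfies, for every `g ∈ ⟨σ⟩`:
`τS^{m g} (ψ_T f) = ψ_T (g • f)` in `S` (the intertwining hypothesis for `Sg := τS^{m g}`), and an
element of `S` is fixed by all `τS^{m g}` iff it is `τS`-fixed — so the `⟨σ⟩`-invariants of the chart
ring read through `ψ_T` are exactly the `Σ_T`-fixed elements ((G1c) `BlowupExitAway.fixedPoints_adjoin_away_eq`
+ p501651). [OURS · L1 W4.5c] -/
theorem exists_twistedChart_expo_algebraMap_and_fixed_iff (h2 : (2 : k) ≠ 0) (h3 : (3 : k) ≠ 0)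
    [Finite (Subgroup.zpowers σ)] {S : Type*} [CommRing S] [Algebra k S]
    [Algebra (MvPolynomial (Fin n) k) S] (τS : S →ₐ[k] S)
    (hτS : ∀ r, τS (algebraMap (MvPolynomial (Fin n) k) S r) =
      algebraMap (MvPolynomial (Fin n) k) S (τ r)) :
    ∃ m : Subgroup.zpowers σ → ℕ, m ⟨σ, Subgroup.mem_zpowers σ⟩ = 1 ∧
      (∀ (g : Subgroup.zpowers σ) (f : MvPolynomial (Fin n) k),
        (τS ^ m g) (algebraMap (MvPolynomial (Fin n) k) S (twistedChart k n a b c d f)) =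
          algebraMap (MvPolynomial (Fin n) k) S (twistedChart k n a b c d
            (MulSemiringAction.toRingEquiv (Subgroup.zpowers σ) (MvPolynomial (Fin n) k) g f))) ∧
      ∀ x : S, (∀ g : Subgroup.zpowers σ, (τS ^ m g) x = x) ↔ τS x = x :=
  exists_expo_algebraMap_and_fixed_iff (twistedChart k n a b c d) σ τ
    (twistedChart_map k n a b c d hab hac had hbc hbd hcd τ hτc hτ
      (σ : MvPolynomial (Fin n) k →ₐ[k] MvPolynomial (Fin n) k) hσb hσc hσd hσ h2 h3)
    τS hτS

end Twisted

end Summit.ResolutionOfSingularities.ResolutionOfSingularities.Theorems.WildQuotientResolution.JordanFour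

end
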